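import Literature.Analysis.Complex.RiemannMapping
import Mathlib.Analysis.Complex.Schwarz
import HarnessLib

/-!
# The holomorphic automorphisms of the unit disc

Topic `Literature/Analysis/Complex`.  The classical description of the group `Aut(𝔻)` of
biholomorphic self-maps of the open unit disc `𝔻 = {‖z‖ < 1} ⊆ ℂ` (Conway, *Functions of one
complex variable I*, Ch. VI Prop. 2.2 – Thm. 2.5):

* `Literature.Analysis.Complex.IsDiscAut f`: `f : ℂ → ℂ` restricts to a holomorphic self-map of
  `𝔻` which admits a holomorphic inverse self-map of `𝔻` (the members of `Aut(𝔻)`, as total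
  functions; values outside the ball are irrelevant).
* `Literature.Analysis.Complex.discRot c a` — the Möbius map `z ↦ c · φ_a(z)` with
  `φ_a(z) = (z - a)/(1 - ā z)` the tree's `Complex.discMobius a` (`RiemannMapping.lean`).
* `IsDiscAut.exists_eq_mul_of_map_zero` — **Schwarz**: an automorphism fixing `0` is a rotation
  `z ↦ c z`, `‖c‖ = 1` (Conway VI.2.5, proof; Mathlib's equality case of the Schwarz lemma
  `Complex.affine_of_mapsTo_ball_of_norm_dslope_eq_div`).
* `IsDiscAut.exists_eq_discRot` — **Conway VI.2.5**: every automorphism of `𝔻` is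
  `z ↦ c · φ_a(z)` with `‖c‖ = 1`, `‖a‖ < 1`; conversely `isDiscAut_discRot`.
* `IsDiscAut.eq_neg_of_involutive` — an involutive automorphism fixing `0` and not the identity
  is `z ↦ -z` (used for the half-turns of the hyperbolic plane in
  `UnitDiscHyperbolic.lean`).

These serve the discharge of [AbsTopIII] Prop. 2.2 (Mochizuki, *Topics in absolute anabelian
geometry III*, §2: "`Aut^hol` of an Aut-holomorphic disc") in
`Literature/AnabelianGeometry/AbsoluteAnabelian/`.

## Mathlib / tree

USED: `Complex.norm_le_norm_of_mapsTo_ball` (Schwarz lemma),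
`Complex.affine_of_mapsTo_ball_of_norm_dslope_eq_div` (its equality case), the tree's
`Complex.discMobius` API (`mapsTo_discMobius`, `discMobius_neg_discMobius`,
`differentiableOn_discMobius`).  NOT here: the topology of `Aut(𝔻)` and the identification with
`PSL₂(ℝ)` as a topological group.
-/

noncomputable section

open Set Filter Metric Function
open _root_.Complex
open scoped ComplexConjugate Topology

namespace Literature.Analysis.Complex

/-! ### Automorphisms of the disc as total functions -/

/-- `f : ℂ → ℂ` is (the total extension of) a **holomorphic automorphism of the unit disc**:
`f` is holomorphic on `𝔻 = ball 0 1`, maps `𝔻` into `𝔻`, and there is a `g`, holomorphic on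
`𝔻` and mapping `𝔻` into `𝔻`, with `g ∘ f = id` and `f ∘ g = id` on `𝔻`.
[cite: Conway1978, Ch. VI Thm. 2.5] -/
structure IsDiscAut (f : ℂ → ℂ) : Prop where
  differentiableOn : DifferentiableOn ℂ f (ball 0 1)
  mapsTo : MapsTo f (ball 0 1) (ball 0 1)
  exists_inverse : ∃ g : ℂ → ℂ, DifferentiableOn ℂ g (ball 0 1) ∧ MapsTo g (ball 0 1) (ball 0 1) ∧
    (∀ z ∈ ball (0 : ℂ) 1, g (f z) = z) ∧ ∀ z ∈ ball (0 : ℂ) 1, f (g z) = z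

namespace IsDiscAut

variable {f g : ℂ → ℂ}

/-- Build an automorphism from an explicit two-sided inverse. [cite: Conway1978, Ch. VI Thm. 2.5] -/
theorem mk' (hf : DifferentiableOn ℂ f (ball 0 1)) (hfm : MapsTo f (ball 0 1) (ball 0 1))
    (hg : DifferentiableOn ℂ g (ball 0 1)) (hgm : MapsTo g (ball 0 1) (ball 0 1))
    (hgf : ∀ z ∈ ball (0 : ℂ) 1, g (f z) = z) (hfg : ∀ z ∈ ball (0 : ℂ) 1, f (g z) = z) :
    IsDiscAut f :=
  ⟨hf, hfm, g, hg, hgm, hgf, hfg⟩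

/-- The inverse of an automorphism is an automorphism. [cite: Conway1978, Ch. VI Thm. 2.5] -/
theorem symm (hf : DifferentiableOn ℂ f (ball 0 1)) (hfm : MapsTo f (ball 0 1) (ball 0 1))
    (hg : DifferentiableOn ℂ g (ball 0 1)) (hgm : MapsTo g (ball 0 1) (ball 0 1))
    (hgf : ∀ z ∈ ball (0 : ℂ) 1, g (f z) = z) (hfg : ∀ z ∈ ball (0 : ℂ) 1, f (g z) = z) :
    IsDiscAut g :=
  ⟨hg, hgm, f, hf, hfm, hfg, hgf⟩

/-- An automorphism is injective on the disc. [cite: Conway1978, Ch. VI Thm. 2.5] -/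
theorem injOn (hf : IsDiscAut f) : InjOn f (ball 0 1) := by
  obtain ⟨g, -, -, hgf, -⟩ := hf.exists_inverse
  intro x hx y hy hxy
  rw [← hgf x hx, ← hgf y hy, hxy]

/-- An automorphism is surjective onto the disc. [cite: Conway1978, Ch. VI Thm. 2.5] -/
theorem surjOn (hf : IsDiscAut f) : SurjOn f (ball 0 1) (ball 0 1) := by
  obtain ⟨g, -, hgm, -, hfg⟩ := hf.exists_inverse
  intro w hw
  exact ⟨g w, hgm hw, hfg w hw⟩

/-- An automorphism is continuous on the disc. [cite: Conway1978, Ch. VI Thm. 2.5] -/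
theorem continuousOn (hf : IsDiscAut f) : ContinuousOn f (ball 0 1) :=
  hf.differentiableOn.continuousOn

/-- Composition of automorphisms is an automorphism. [cite: Conway1978, Ch. VI Thm. 2.5] -/
theorem comp (hf : IsDiscAut f) (hg : IsDiscAut g) : IsDiscAut (f ∘ g) := by
  obtain ⟨f', hf'd, hf'm, hf'f, hff'⟩ := hf.exists_inverse
  obtain ⟨g', hg'd, hg'm, hg'g, hgg'⟩ := hg.exists_inverse
  refine ⟨hf.differentiableOn.comp hg.differentiableOn hg.mapsTo, hf.mapsTo.comp hg.mapsTo,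
    g' ∘ f', hg'd.comp hf'd hf'm, hg'm.comp hf'm, fun z hz => ?_, fun z hz => ?_⟩
  · simp only [comp_apply]
    rw [hf'f _ (hg.mapsTo hz), hg'g z hz]
  · simp only [comp_apply]
    rw [hgg' _ (hf'm hz), hff' z hz]

/-- Automorphisms agreeing on the disc: `IsDiscAut` only depends on the values on the disc.
[cite: Conway1978, Ch. VI Thm. 2.5] -/
theorem congr (hf : IsDiscAut f) (hfg : EqOn f g (ball 0 1)) : IsDiscAut g := by
  obtain ⟨f', hf'd, hf'm, hf'f, hff'⟩ := hf.exists_inverse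
  refine ⟨hf.differentiableOn.congr fun z hz => (hfg hz).symm,
    fun z hz => hfg hz ▸ hf.mapsTo hz, f', hf'd, hf'm, fun z hz => ?_, fun z hz => ?_⟩
  · rw [← hfg hz, hf'f z hz]
  · rw [← hfg (hf'm hz), hff' z hz]

end IsDiscAut

/-! ### Rotations and Möbius maps are automorphisms -/

/-- The identity is an automorphism of the disc. [cite: Conway1978, Ch. VI Thm. 2.5] -/
theorem isDiscAut_id : IsDiscAut id :=
  ⟨differentiableOn_id, mapsTo_id _, id, differentiableOn_id, mapsTo_id _, fun _ _ => rfl,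
    fun _ _ => rfl⟩

/-- A rotation `z ↦ c z`, `‖c‖ = 1`, maps the disc into itself. [cite: Conway1978, Ch. VI Thm. 2.5] -/
theorem mapsTo_mul_ball {c : ℂ} (hc : ‖c‖ = 1) : MapsTo (fun z : ℂ => c * z) (ball 0 1) (ball 0 1) := by
  intro z hz
  rw [mem_ball_zero_iff] at hz ⊢
  rw [norm_mul, hc, one_mul]
  exact hz

/-- A rotation `z ↦ c z`, `‖c‖ = 1`, is an automorphism of the disc, with inverse `z ↦ c⁻¹ z`.
[cite: Conway1978, Ch. VI Thm. 2.5] -/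
theorem isDiscAut_mul {c : ℂ} (hc : ‖c‖ = 1) : IsDiscAut fun z : ℂ => c * z := by
  have hc0 : c ≠ 0 := norm_ne_zero_iff.1 (by rw [hc]; exact one_ne_zero)
  have hc' : ‖c⁻¹‖ = 1 := by rw [norm_inv, hc, inv_one]
  refine ⟨(differentiableOn_id.const_mul c), mapsTo_mul_ball hc, fun z => c⁻¹ * z,
    differentiableOn_id.const_mul _, mapsTo_mul_ball hc', fun z _ => ?_, fun z _ => ?_⟩
  · show c⁻¹ * (c * z) = z
    rw [← mul_assoc, inv_mul_cancel₀ hc0, one_mul]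
  · show c * (c⁻¹ * z) = z
    rw [← mul_assoc, mul_inv_cancel₀ hc0, one_mul]

/-- The Möbius map `φ_a`, `‖a‖ < 1`, is an automorphism of the disc with inverse `φ_{-a}`
(Conway VI.2.2). [cite: Conway1978, Ch. VI Prop. 2.2] -/
theorem isDiscAut_discMobius {a : ℂ} (ha : ‖a‖ < 1) : IsDiscAut (discMobius a) := by
  have ha' : ‖-a‖ < 1 := by rwa [norm_neg]
  refine ⟨differentiableOn_discMobius ha, mapsTo_discMobius ha, discMobius (-a),
    differentiableOn_discMobius ha', mapsTo_discMobius ha', fun z hz => ?_, fun z hz => ?_⟩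
  · exact discMobius_neg_discMobius ha (mem_ball_zero_iff.1 hz).le
  · simpa using discMobius_neg_discMobius ha' (mem_ball_zero_iff.1 hz).le

/-- The **general Möbius automorphism** `z ↦ c · φ_a(z)` of the disc (`‖c‖ = 1`, `‖a‖ < 1`):
a rotation composed with `φ_a`. [cite: Conway1978, Ch. VI Thm. 2.5] -/
def discRot (c a : ℂ) (z : ℂ) : ℂ := c * discMobius a z

/-- Unfolding `discRot`. [cite: Conway1978, Ch. VI Thm. 2.5] -/
theorem discRot_apply (c a z : ℂ) : discRot c a z = c * discMobius a z := rfl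

/-- `discRot c a a = 0`. [cite: Conway1978, Ch. VI Thm. 2.5] -/
@[simp] theorem discRot_self (c a : ℂ) : discRot c a a = 0 := by simp [discRot]

/-- `discRot c a 0 = -c a`. [cite: Conway1978, Ch. VI Thm. 2.5] -/
@[simp] theorem discRot_zero (c a : ℂ) : discRot c a 0 = -(c * a) := by simp [discRot]

/-- `discRot c 0` is the rotation `z ↦ c z`. [cite: Conway1978, Ch. VI Thm. 2.5] -/
@[simp] theorem discRot_zero_right (c z : ℂ) : discRot c 0 z = c * z := by simp [discRot, discMobius]

/-- `z ↦ c · φ_a(z)` is an automorphism of the disc. [cite: Conway1978, Ch. VI Thm. 2.5] -/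
theorem isDiscAut_discRot {c a : ℂ} (hc : ‖c‖ = 1) (ha : ‖a‖ < 1) : IsDiscAut (discRot c a) :=
  (isDiscAut_mul hc).comp (isDiscAut_discMobius ha)

/-- `discRot c a` maps the disc into the disc. [cite: Conway1978, Ch. VI Thm. 2.5] -/
theorem norm_discRot_lt_one {c a z : ℂ} (hc : ‖c‖ = 1) (ha : ‖a‖ < 1) (hz : ‖z‖ < 1) :
    ‖discRot c a z‖ < 1 := by
  rw [discRot, norm_mul, hc, one_mul]
  exact norm_discMobius_lt_one ha hz

/-! ### Schwarz: automorphisms fixing the origin are rotations -/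

namespace IsDiscAut

variable {f g : ℂ → ℂ}

/-- An automorphism fixing `0` preserves the norm: `‖f z‖ = ‖z‖` on the disc (Schwarz's lemma
applied to `f` and to its inverse; Conway VI.2.5, proof). [cite: Conway1978, Ch. VI Thm. 2.5] -/
theorem norm_eq_of_map_zero (hf : IsDiscAut f) (h0 : f 0 = 0) {z : ℂ} (hz : ‖z‖ < 1) :
    ‖f z‖ = ‖z‖ := by
  obtain ⟨g, hgd, hgm, hgf, -⟩ := hf.exists_inverse
  have hmaps : MapsTo f (ball 0 1) (closedBall 0 1) := hf.mapsTo.mono_right ball_subset_closedBall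
  have h1 : ‖f z‖ ≤ ‖z‖ := norm_le_norm_of_mapsTo_ball hf.differentiableOn hmaps h0 hz
  have hg0 : g 0 = 0 := by simpa [h0] using hgf 0 (mem_ball_self one_pos)
  have hfz : ‖f z‖ < 1 := mem_ball_zero_iff.1 (hf.mapsTo (mem_ball_zero_iff.2 hz))
  have h2 : ‖g (f z)‖ ≤ ‖f z‖ :=
    norm_le_norm_of_mapsTo_ball hgd (hgm.mono_right ball_subset_closedBall) hg0 hfz
  rw [hgf z (mem_ball_zero_iff.2 hz)] at h2
  exact le_antisymm h1 h2

/-- **Schwarz's lemma for automorphisms** (Conway VI.2.5, proof): an automorphism of the disc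
fixing `0` is a rotation `z ↦ c z` with `‖c‖ = 1`. [cite: Conway1978, Ch. VI Thm. 2.5] -/
theorem exists_eq_mul_of_map_zero (hf : IsDiscAut f) (h0 : f 0 = 0) :
    ∃ c : ℂ, ‖c‖ = 1 ∧ EqOn f (fun z => c * z) (ball 0 1) := by
  set z₀ : ℂ := 1 / 2 with hz₀
  have hz₀1 : ‖z₀‖ < 1 := by rw [hz₀]; norm_num
  have hz₀0 : z₀ ≠ 0 := by rw [hz₀]; norm_num
  have hz₀mem : z₀ ∈ ball (0 : ℂ) 1 := mem_ball_zero_iff.2 hz₀1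
  have hmaps : MapsTo f (ball 0 1) (closedBall (f 0) 1) := by
    rw [h0]; exact hf.mapsTo.mono_right ball_subset_closedBall
  have hslope : ‖dslope f 0 z₀‖ = 1 / 1 := by
    rw [dslope_of_ne _ hz₀0, slope_def_field, h0, sub_zero, sub_zero, norm_div,
      hf.norm_eq_of_map_zero h0 hz₀1, div_self (norm_ne_zero_iff.2 hz₀0), div_one]
  have key := affine_of_mapsTo_ball_of_norm_dslope_eq_div hf.differentiableOn hmaps hz₀mem hslope
  refine ⟨dslope f 0 z₀, by rw [hslope, div_one], fun z hz => ?_⟩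
  have h := key hz
  simp only [h0, zero_add, sub_zero, smul_eq_mul] at h
  rw [h, mul_comm]

/-- An automorphism of the disc with `f 0 = 0` and `f z₁ = z₁` for some `0 ≠ z₁ ∈ 𝔻` is the
identity on the disc. [cite: Conway1978, Ch. VI Thm. 2.5] -/
theorem eqOn_id_of_map_zero_of_fixed (hf : IsDiscAut f) (h0 : f 0 = 0) {z₁ : ℂ} (hz₁ : ‖z₁‖ < 1)
    (hz₁0 : z₁ ≠ 0) (hfix : f z₁ = z₁) : EqOn f id (ball 0 1) := by
  obtain ⟨c, -, hfc⟩ := hf.exists_eq_mul_of_map_zero h0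
  have hc1 : c = 1 := by
    have h := hfc (mem_ball_zero_iff.2 hz₁)
    rw [hfix] at h
    exact (mul_eq_right₀ hz₁0).1 h.symm
  intro z hz
  have h := hfc hz
  simp only [hc1, one_mul] at h
  exact h

/-- An **involutive** automorphism fixing `0` is `± id`: if moreover it is not the identity on the
disc, it is `z ↦ -z` there. [cite: Conway1978, Ch. VI Thm. 2.5] -/
theorem eq_neg_of_involutive (hf : IsDiscAut f) (h0 : f 0 = 0)
    (hinv : ∀ z ∈ ball (0 : ℂ) 1, f (f z) = z) (hne : ¬ EqOn f id (ball 0 1)) :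
    EqOn f (fun z => -z) (ball 0 1) := by
  obtain ⟨c, hc, hfc⟩ := hf.exists_eq_mul_of_map_zero h0
  set z₀ : ℂ := 1 / 2 with hz₀
  have hz₀1 : z₀ ∈ ball (0 : ℂ) 1 := by rw [mem_ball_zero_iff, hz₀]; norm_num
  have hz₀0 : z₀ ≠ 0 := by rw [hz₀]; norm_num
  have hcc : c * c = 1 := by
    have h1 := hinv z₀ hz₀1
    rw [hfc hz₀1, hfc (mapsTo_mul_ball hc hz₀1)] at h1
    simp only at h1
    rw [← mul_assoc] at h1
    exact (mul_eq_right₀ hz₀0).1 h1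
  have hc1 : c ≠ 1 := by
    intro h
    apply hne
    intro z hz
    have h' := hfc hz
    simp only [h, one_mul] at h'
    exact h'
  have hcm : c = -1 := by
    have : (c - 1) * (c + 1) = 0 := by
      rw [show (c - 1) * (c + 1) = c * c - 1 by ring, hcc, sub_self]
    rcases mul_eq_zero.1 this with h | h
    · exact absurd (sub_eq_zero.1 h) hc1
    · exact eq_neg_of_add_eq_zero_left h
  intro z hz
  have h := hfc hz
  simp only [hcm, neg_one_mul] at h
  exact h

/-! ### Conway VI.2.5: `Aut(𝔻) = {z ↦ c·φ_a(z)}` -/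

/-- **The automorphisms of the disc** (Conway VI.2.5): every holomorphic automorphism `f` of the
unit disc is `z ↦ c · φ_a(z)` on the disc, for a (unique) `a ∈ 𝔻` — the point with `f a = 0` —
and a constant `‖c‖ = 1`. [cite: Conway1978, Ch. VI Thm. 2.5] -/
theorem exists_eq_discRot (hf : IsDiscAut f) :
    ∃ c a : ℂ, ‖c‖ = 1 ∧ ‖a‖ < 1 ∧ f a = 0 ∧ EqOn f (discRot c a) (ball 0 1) := by
  obtain ⟨g, hgd, hgm, hgf, hfg⟩ := hf.exists_inverse
  set a : ℂ := g 0 with ha_def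
  have ha : ‖a‖ < 1 := mem_ball_zero_iff.1 (hgm (mem_ball_self one_pos))
  have hfa : f a = 0 := hfg 0 (mem_ball_self one_pos)
  have ha' : ‖-a‖ < 1 := by rwa [norm_neg]
  -- `F := f ∘ φ_{-a}` is an automorphism fixing `0`
  have hF : IsDiscAut (f ∘ discMobius (-a)) := hf.comp (isDiscAut_discMobius ha')
  have hF0 : (f ∘ discMobius (-a)) 0 = 0 := by
    simp only [comp_apply, discMobius_zero, neg_neg, hfa]
  obtain ⟨c, hc, hFc⟩ := hF.exists_eq_mul_of_map_zero hF0
  refine ⟨c, a, hc, ha, hfa, fun z hz => ?_⟩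
  have hz' : ‖z‖ < 1 := mem_ball_zero_iff.1 hz
  have hmem : discMobius a z ∈ ball (0 : ℂ) 1 := mapsTo_discMobius ha hz
  have h := hFc hmem
  simp only [comp_apply] at h
  rw [show discMobius (-a) (discMobius a z) = z from discMobius_neg_discMobius ha hz'.le] at h
  rw [h, discRot]

/-- The point `a` of Conway VI.2.5 is the unique zero of `f` in the disc: if `f a = 0` with
`‖a‖ < 1` then `f = c · φ_a` on the disc for some `‖c‖ = 1`. [cite: Conway1978, Ch. VI Thm. 2.5] -/
theorem exists_eq_discRot_of_map_eq_zero (hf : IsDiscAut f) {a : ℂ} (ha : ‖a‖ < 1) (hfa : f a = 0) :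
    ∃ c : ℂ, ‖c‖ = 1 ∧ EqOn f (discRot c a) (ball 0 1) := by
  obtain ⟨c, a', hc, ha', hfa', hfc⟩ := hf.exists_eq_discRot
  have haa : a' = a := hf.injOn (mem_ball_zero_iff.2 ha') (mem_ball_zero_iff.2 ha) (hfa'.trans hfa.symm)
  exact ⟨c, hc, haa ▸ hfc⟩

/-- The stabiliser of `0` in `Aut(𝔻)` is the rotation group: an automorphism with `f 0 = 0` is
`discRot c 0 = (c · )`. [cite: Conway1978, Ch. VI Thm. 2.5] -/
theorem exists_eq_discRot_zero (hf : IsDiscAut f) (h0 : f 0 = 0) :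
    ∃ c : ℂ, ‖c‖ = 1 ∧ EqOn f (discRot c 0) (ball 0 1) :=
  hf.exists_eq_discRot_of_map_eq_zero (by simp) h0

end IsDiscAut

/-! ### Transitivity -/

/-- `Aut(𝔻)` acts transitively on the disc: `φ_{-b} ∘ φ_a` is an automorphism taking `a` to `b`.
[cite: Conway1978, Ch. VI Prop. 2.2] -/
theorem exists_isDiscAut_apply_eq {a b : ℂ} (ha : ‖a‖ < 1) (hb : ‖b‖ < 1) :
    ∃ f : ℂ → ℂ, IsDiscAut f ∧ f a = b := by
  have hb' : ‖-b‖ < 1 := by rwa [norm_neg]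
  refine ⟨discMobius (-b) ∘ discMobius a, (isDiscAut_discMobius hb').comp (isDiscAut_discMobius ha),
    ?_⟩
  simp only [comp_apply, discMobius_self, discMobius_zero, neg_neg]

/-- Two-point data: an automorphism taking `a` to `0` exists for every `a ∈ 𝔻`, namely `φ_a`.
[cite: Conway1978, Ch. VI Prop. 2.2] -/
theorem exists_isDiscAut_apply_eq_zero {a : ℂ} (ha : ‖a‖ < 1) :
    ∃ f : ℂ → ℂ, IsDiscAut f ∧ f a = 0 :=
  ⟨discMobius a, isDiscAut_discMobius ha, discMobius_self a⟩

end Literature.Analysis.Complex
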